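import Mathlib
import Literature.NumberTheory.Irrationality.DirichletLValues.ChowlaMilnorSmallModuliProofs
import Literature.NumberTheory.Transcendental.PeriodsWave0Proofs
import HarnessLib

/-!
# The extended Chowla–Milnor spaces `V̂_k(3), V̂_k(4)` and `ζ(k) ∉ ℚ`: Gun–Murty–Rath's Proposition 7 and its Remark

Topic `Literature/NumberTheory/Irrationality/DirichletLValues`. Fourth proofs-only file on the UNCONDITIONAL half of
S. Gun, M. R. Murty, P. Rath, *On a conjecture of Chowla and Milnor*, Canad. J. Math. **63** (2011) 1328–1344
[GunRammurtyRath2011], after `ChowlaMilnorSpaceProofs.lean`, `ChowlaMilnorCoprimeModuliProofs.lean`,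
`ChowlaMilnorSmallModuliProofs.lean` (the latter supplies `ζ(k,1/3) ± ζ(k,2/3)`, `ζ(k,1/4) ± ζ(k,3/4)` and
`π^k ∉ ℚ + ℚ√3`). Read on the page (pp. 1342–1343):

* "For any integer `k > 1`, let `V̂_k(q)` be the `ℚ`-linear space spanned by `{1, ζ(k, a/q) : 1 ≤ a < q, (a, q) = 1}`."
* **Proposition 7.** "Let `k > 1` be an odd integer. Then the following statements are equivalent:
  (i) Either `dim_ℚ V̂_k(3) = 3` or `dim_ℚ V̂_k(4) = 3`. (ii) The number `ζ(k)` is irrational."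
  Proof: "(i) implies (ii)" by the two distribution relations; "Conversely, suppose that (i) is false … we have
  `(3^k − 1)ζ(k) = a√3π^k + b` and `(4^k − 2^k)ζ(k) = cπ^k + d` where `a, b, c, d` are all rational numbers. Since
  `π` is transcendental and `√3` is algebraic irrational, we have `a = c = 0` and hence `ζ(k)` is rational." (The
  degenerate relations not involving `ζ(k, a/q) + ζ(k, 1 − a/q)`, which the printed proof passes over, are handled
  here by the same transcendence input: they would put `π^k` or `√3 π^k` in `ℚ`.)
* **Remark.** "Since it has been established by Apéry that `ζ(3)` is irrational, we have that either
  `dim_ℚ V̂₃(3) = 3` or `dim_ℚ V̂₃(4) = 3`. Further, by a result of Rivoal and Ball, `ζ(k)` is irrational for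
  infinitely many odd `k`. Thus for infinitely many odd `k`, either `dim_ℚ V̂_k(3) = 3` or `dim_ℚ V̂_k(4) = 3`."

## What is proved (theorems only; no definition is introduced)

`V̂_k(q)` is WRITTEN OUT as `Submodule.span ℚ (insert 1 {y | ∃ a, 1 ≤ a ∧ a < q ∧ Nat.Coprime a q ∧ y = hurwitzValue k (a/q)})`.
* `finrank_span_insert_three_eq_three_iff`, `finrank_span_insert_four_eq_three_iff` — `dim_ℚ V̂_k(3) = 3`
  (resp. `V̂_k(4)`) iff `1, ζ(k,1/3), ζ(k,2/3)` (resp. `1, ζ(k,1/4), ζ(k,3/4)`) are `ℚ`-linearly independent;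
* **`finrank_three_or_four_eq_three_iff_irrational`** — PROPOSITION 7 (both directions; `⟸` via the tree's
  Lindemann theorem through `pi_pow_ne_add_mul_sqrt_three` and Mathlib's `√3 ∉ ℚ`);
* **`finrank_three_or_four_eq_three_of_three`** (Apéry: tree `irrational_zetaValue_three_holds`) and
  **`infinite_setOf_finrank_three_or_four_eq_three`** (Ball–Rivoal: tree `infinite_setOf_irrational_zetaValue_odd_holds`)
  — the REMARK, unconditionally.

HONEST FRAMING (cells pub-zeta5 / zeta5-irr): kernel theorems of PRINTED statements; the only irrationality /
transcendence INPUTS are the tree's theorems of Apéry, Ball–Rivoal and Lindemann, by name; net named-fact debt 0;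
the Chowla–Milnor conjecture (and its `q = 3, 4` cases for any single `k`) stays OPEN and untyped; nothing here
concerns `ζ(5)`.
-/

noncomputable section

open Finset

open scoped Nat

namespace Literature.NumberTheory.Irrationality.DirichletLValues

open Literature.NumberTheory.Transcendental

/-! ### `V̂_k(3)`, `V̂_k(4)` have three generators -/

/-- `{1} ∪ {ζ(k, a/3) : a = 1, 2}` is the range of `(1, ζ(k,1/3), ζ(k,2/3))`. [folklore] -/
private theorem insert_generators_three (k : ℕ) :
    insert (1 : ℝ) {y : ℝ | ∃ a : ℕ, 1 ≤ a ∧ a < 3 ∧ Nat.Coprime a 3 ∧ y = hurwitzValue k ((a : ℝ) / (3 : ℕ))} =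
      Set.range ![(1 : ℝ), hurwitzValue k (1 / 3), hurwitzValue k (2 / 3)] := by
  ext y
  simp only [Set.mem_insert_iff, Set.mem_setOf_eq, Set.mem_range]
  constructor
  · rintro (rfl | ⟨a, ha1, ha3, -, rfl⟩)
    · exact ⟨0, by simp⟩
    · interval_cases a
      · exact ⟨1, by simp⟩
      · exact ⟨2, by simp⟩
  · rintro ⟨i, rfl⟩
    fin_cases i
    · exact Or.inl (by simp)
    · exact Or.inr ⟨1, le_rfl, by norm_num, by decide, by simp⟩
    · exact Or.inr ⟨2, by norm_num, by norm_num, by decide, by simp⟩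

/-- `{1} ∪ {ζ(k, a/4) : a = 1, 3}` is the range of `(1, ζ(k,1/4), ζ(k,3/4))`. [folklore] -/
private theorem insert_generators_four (k : ℕ) :
    insert (1 : ℝ) {y : ℝ | ∃ a : ℕ, 1 ≤ a ∧ a < 4 ∧ Nat.Coprime a 4 ∧ y = hurwitzValue k ((a : ℝ) / (4 : ℕ))} =
      Set.range ![(1 : ℝ), hurwitzValue k (1 / 4), hurwitzValue k (3 / 4)] := by
  ext y
  simp only [Set.mem_insert_iff, Set.mem_setOf_eq, Set.mem_range]
  constructor
  · rintro (rfl | ⟨a, ha1, ha4, hcop, rfl⟩)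
    · exact ⟨0, by simp⟩
    · interval_cases a
      · exact ⟨1, by simp⟩
      · exact absurd hcop (by decide)
      · exact ⟨2, by simp⟩
  · rintro ⟨i, rfl⟩
    fin_cases i
    · exact Or.inl (by simp)
    · exact Or.inr ⟨1, le_rfl, by norm_num, by decide, by simp⟩
    · exact Or.inr ⟨3, by norm_num, by norm_num, by decide, by simp⟩

/-- **`dim_ℚ V̂_k(3) = 3` iff `1, ζ(k,1/3), ζ(k,2/3)` are `ℚ`-linearly independent** (three generators).
[cite: GunRammurtyRath2011, §4 (p. 1342), definition of V̂_k(q)] -/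
theorem finrank_span_insert_three_eq_three_iff (k : ℕ) :
    Module.finrank ℚ ↥(Submodule.span ℚ (insert (1 : ℝ) {y : ℝ | ∃ a : ℕ, 1 ≤ a ∧ a < 3 ∧ Nat.Coprime a 3 ∧
        y = hurwitzValue k ((a : ℝ) / (3 : ℕ))})) = 3 ↔
      LinearIndependent ℚ ![(1 : ℝ), hurwitzValue k (1 / 3), hurwitzValue k (2 / 3)] := by
  rw [insert_generators_three, linearIndependent_iff_card_eq_finrank_span, Fintype.card_fin, Set.finrank, eq_comm]

/-- **`dim_ℚ V̂_k(4) = 3` iff `1, ζ(k,1/4), ζ(k,3/4)` are `ℚ`-linearly independent** (three generators).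
[cite: GunRammurtyRath2011, §4 (p. 1342), definition of V̂_k(q)] -/
theorem finrank_span_insert_four_eq_three_iff (k : ℕ) :
    Module.finrank ℚ ↥(Submodule.span ℚ (insert (1 : ℝ) {y : ℝ | ∃ a : ℕ, 1 ≤ a ∧ a < 4 ∧ Nat.Coprime a 4 ∧
        y = hurwitzValue k ((a : ℝ) / (4 : ℕ))})) = 3 ↔
      LinearIndependent ℚ ![(1 : ℝ), hurwitzValue k (1 / 4), hurwitzValue k (3 / 4)] := by
  rw [insert_generators_four, linearIndependent_iff_card_eq_finrank_span, Fintype.card_fin, Set.finrank, eq_comm]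

/-! ### From a linear relation to a representation of `ζ(k)` -/

/-- A rational value `ζ(k) = ρ` gives the non-trivial relation `c·ρ·1 − u − v = 0` whenever `u + v = c·ζ(k)`.
[folklore] -/
private theorem not_linearIndependent_of_rat {k : ℕ} {u v c : ℝ} {ρ cq : ℚ} (hζ : zetaValue k = ρ) (hc : c = cq)
    (hS : u + v = c * zetaValue k) : ¬ LinearIndependent ℚ ![(1 : ℝ), u, v] := by
  rw [Fintype.not_linearIndependent_iff]
  refine ⟨![cq * ρ, -1, -1], ?_, 1, by simp⟩
  simp only [Fin.sum_univ_three, Matrix.cons_val_zero, Matrix.cons_val_one, Matrix.cons_val_two,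
    Matrix.head_cons, Matrix.tail_cons, Rat.smul_def]
  push_cast
  rw [← hζ, ← hc]
  linear_combination -hS

variable {k : ℕ}

/-- From a non-trivial rational relation among `1, u, v` with `u + v = S`, `u − v = D`:
either `S = a + b·D` with `a, b ∈ ℚ`, or `D ∈ ℚ` (the latter when the relation does not involve `S`). [folklore] -/
private theorem rat_form_of_not_linearIndependent {u v S D : ℝ} (hS : u + v = S) (hD : u - v = D)
    (h : ¬ LinearIndependent ℚ ![(1 : ℝ), u, v]) :
    (∃ a b : ℚ, S = a + b * D) ∨ ∃ r : ℚ, D = r := by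
  rw [Fintype.not_linearIndependent_iff] at h
  obtain ⟨g, hg, i, hi⟩ := h
  simp only [Fin.sum_univ_three, Matrix.cons_val_zero, Matrix.cons_val_one, Matrix.cons_val_two,
    Matrix.head_cons, Matrix.tail_cons, Rat.smul_def] at hg
  -- `2 g₀ + (g₁ + g₂) S + (g₁ − g₂) D = 0`
  have key : 2 * (g 0 : ℝ) + ((g 1 : ℝ) + g 2) * S + ((g 1 : ℝ) - g 2) * D = 0 := by
    rw [← hS, ← hD]
    linear_combination 2 * hg
  by_cases h12 : g 1 + g 2 = 0
  · right
    have h12' : (g 1 : ℝ) + g 2 = 0 := by exact_mod_cast h12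
    by_cases h1 : g 1 = 0
    · exfalso
      have h2 : g 2 = 0 := by linear_combination h12 - h1
      have h0 : g 0 = 0 := by
        have : 2 * (g 0 : ℝ) = 0 := by
          rw [h12', h1, h2] at key
          simpa using key
        exact_mod_cast (by linarith : (g 0 : ℝ) = 0)
      fin_cases i <;> simp_all
    · refine ⟨-(g 0) / (g 1), ?_⟩
      have hg1 : (g 1 : ℝ) ≠ 0 := by exact_mod_cast h1
      have h2 : (g 2 : ℝ) = -g 1 := by linear_combination h12'
      rw [h2] at key
      push_cast
      field_simp
      linear_combination key / 2
  · left
    have h12' : (g 1 : ℝ) + g 2 ≠ 0 := by exact_mod_cast h12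
    refine ⟨-2 * g 0 / (g 1 + g 2), -(g 1 - g 2) / (g 1 + g 2), ?_⟩
    push_cast
    field_simp
    linear_combination key

/-- `√3 ∉ ℚ` in the form needed: `3 b² ≠ d²` for rationals `b ≠ 0` or `d ≠ 0`. [folklore] -/
private theorem three_mul_sq_ne_sq {b d : ℚ} (h : b ≠ 0 ∨ d ≠ 0) : 3 * b ^ 2 ≠ d ^ 2 := by
  intro h3
  have hb : b ≠ 0 := by
    rcases h with hb | hd
    · exact hb
    · rintro rfl
      exact hd (pow_eq_zero_iff two_ne_zero |>.1 (by linear_combination -h3))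
  have hsq : ((d / b : ℚ) : ℝ) ^ 2 = 3 := by
    have : (d / b) ^ 2 = (3 : ℚ) := by field_simp; linear_combination -h3
    exact_mod_cast this
  have habs : Real.sqrt 3 = |((d / b : ℚ) : ℝ)| := by
    rw [← hsq, Real.sqrt_sq_eq_abs]
  exact (Nat.prime_three.irrational_sqrt).ne_rat |d / b| (by rw [Rat.cast_abs, ← habs]; norm_num)

/-! ### Proposition 7 -/

/-- **Gun–Murty–Rath 2011, Proposition 7.** "Let `k > 1` be an odd integer. Then the following statements are
equivalent: (i) Either `dim_ℚ V̂_k(3) = 3` or `dim_ℚ V̂_k(4) = 3`. (ii) The number `ζ(k)` is irrational."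
(`V̂_k(q) = Span_ℚ {1, ζ(k, a/q) : 1 ≤ a < q, (a,q) = 1}`, written out over `hurwitzValue`.) (i) ⟹ (ii): a rational
`ζ(k)` gives the relations `(3^k − 1)ζ(k)·1 − ζ(k,1/3) − ζ(k,2/3) = 0`, `(4^k − 2^k)ζ(k)·1 − ζ(k,1/4) − ζ(k,3/4) = 0`.
(ii) ⟹ (i): if both triples are dependent then `(3^k − 1)ζ(k) = b + a√3π^k` and `(4^k − 2^k)ζ(k) = d + cπ^k` with
rational `a, b, c, d` (or `√3π^k`, resp. `π^k`, is rational), and eliminating `ζ(k)` puts `π^k` in `ℚ + ℚ√3` unless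
`a = c = 0` — Lindemann (`pi_pow_ne_add_mul_sqrt_three`) and `√3 ∉ ℚ`. [cite: GunRammurtyRath2011, Proposition 7 (pp. 1342–1343)] -/
theorem finrank_three_or_four_eq_three_iff_irrational (hk : Odd k) (hk1 : 1 < k) :
    (Module.finrank ℚ ↥(Submodule.span ℚ (insert (1 : ℝ) {y : ℝ | ∃ a : ℕ, 1 ≤ a ∧ a < 3 ∧ Nat.Coprime a 3 ∧
        y = hurwitzValue k ((a : ℝ) / (3 : ℕ))})) = 3 ∨
      Module.finrank ℚ ↥(Submodule.span ℚ (insert (1 : ℝ) {y : ℝ | ∃ a : ℕ, 1 ≤ a ∧ a < 4 ∧ Nat.Coprime a 4 ∧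
        y = hurwitzValue k ((a : ℝ) / (4 : ℕ))})) = 3) ↔
      Irrational (zetaValue k) := by
  rw [finrank_span_insert_three_eq_three_iff, finrank_span_insert_four_eq_three_iff]
  have hk2 : 2 ≤ k := hk1
  have hk3 : 3 ≤ k := by obtain ⟨m, rfl⟩ := hk; omega
  have hS3 := hurwitzValue_third_add hk2
  have hS4 := hurwitzValue_quarter_add hk2
  obtain ⟨c3, hD3⟩ := exists_rat_hurwitzValue_third_sub hk hk3
  obtain ⟨c4, hD4⟩ := exists_rat_hurwitzValue_quarter_sub hk hk3
  have hD3pos : 0 < hurwitzValue k (1 / 3) - hurwitzValue k (2 / 3) :=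
    sub_pos.2 (hurwitzValue_lt_of_lt (by norm_num) (by norm_num) hk2)
  have hD4pos : 0 < hurwitzValue k (1 / 4) - hurwitzValue k (3 / 4) :=
    sub_pos.2 (hurwitzValue_lt_of_lt (by norm_num) (by norm_num) hk2)
  have hT := fun e f => pi_pow_ne_add_mul_sqrt_three (k := k) (by omega) e f
  constructor
  · -- (i) ⟹ (ii)
    rintro h ⟨ρ, hρ⟩
    rcases h with h | h
    · exact not_linearIndependent_of_rat (c := (3 : ℝ) ^ k - 1) (cq := 3 ^ k - 1) hρ.symm (by push_cast; ring) hS3 h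
    · exact not_linearIndependent_of_rat (c := (4 : ℝ) ^ k - 2 ^ k) (cq := 4 ^ k - 2 ^ k) hρ.symm
        (by push_cast; ring) hS4 h
  · -- (ii) ⟹ (i)
    intro hirr
    by_contra hcon
    rw [not_or] at hcon
    obtain ⟨h3, h4⟩ := hcon
    -- modulus 3: `(3^k − 1)ζ(k) = a + b·(c3 √3 π^k)`, or `c3 √3 π^k ∈ ℚ` (impossible)
    rcases rat_form_of_not_linearIndependent hS3 hD3 h3 with ⟨a, b, hab⟩ | ⟨r, hr⟩
    swap
    · -- `c3 √3 π^k = r` ⟹ `π^k = (r/(3 c3)) √3`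
      have hc3 : (c3 : ℝ) ≠ 0 := by rintro h0; rw [h0, zero_mul, zero_mul] at hD3; exact hD3pos.ne' hD3
      refine hT 0 (r / (3 * c3)) ?_
      have h33 : Real.sqrt 3 * Real.sqrt 3 = 3 := Real.mul_self_sqrt (by norm_num)
      push_cast
      field_simp
      linear_combination Real.sqrt 3 * hr - (c3 : ℝ) * Real.pi ^ k * h33
    -- modulus 4: `(4^k − 2^k)ζ(k) = a' + b'·(c4 π^k)`, or `c4 π^k ∈ ℚ` (impossible)
    rcases rat_form_of_not_linearIndependent hS4 hD4 h4 with ⟨a', b', hab'⟩ | ⟨r, hr⟩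
    swap
    · have hc4 : (c4 : ℝ) ≠ 0 := by rintro h0; rw [h0, zero_mul] at hD4; exact hD4pos.ne' hD4
      refine hT (r / c4) 0 ?_
      push_cast
      field_simp
      linear_combination hr
    -- eliminate `ζ(k)`:  `ζ(k) = α + β √3 π^k = γ + δ π^k`
    have h31 : (3 : ℝ) ^ k - 1 ≠ 0 := by
      have : (1 : ℝ) < 3 ^ k := one_lt_pow₀ (by norm_num) (by omega)
      linarith
    have h42 : (4 : ℝ) ^ k - 2 ^ k ≠ 0 := by
      have : (2 : ℝ) ^ k < 4 ^ k := pow_lt_pow_left₀ (by norm_num) (by norm_num) (by omega)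
      linarith
    set β : ℚ := b * c3 / (3 ^ k - 1) with hβ
    set δ : ℚ := b' * c4 / (4 ^ k - 2 ^ k) with hδ
    set α : ℚ := a / (3 ^ k - 1) with hα
    set γ : ℚ := a' / (4 ^ k - 2 ^ k) with hγ
    have h31q : (3 : ℚ) ^ k - 1 ≠ 0 := by exact_mod_cast h31
    have h42q : (4 : ℚ) ^ k - 2 ^ k ≠ 0 := by exact_mod_cast h42
    have e1 : zetaValue k = α + β * Real.sqrt 3 * Real.pi ^ k := by
      rw [hα, hβ]
      push_cast
      field_simp
      linear_combination hab
    have e2 : zetaValue k = γ + δ * Real.pi ^ k := by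
      rw [hγ, hδ]
      push_cast
      field_simp
      linear_combination hab'
    by_cases hβδ : β = 0 ∧ δ = 0
    · -- then `ζ(k) = γ` is rational
      rw [hβδ.2, Rat.cast_zero, zero_mul, add_zero] at e2
      exact hirr ⟨γ, e2.symm⟩
    · -- else `π^k = (γ − α)(β√3 + δ)/(3β² − δ²) ∈ ℚ + ℚ√3`
      have hN : 3 * β ^ 2 - δ ^ 2 ≠ 0 := sub_ne_zero.2 (three_mul_sq_ne_sq (by tauto))
      have hN' : (3 : ℝ) * β ^ 2 - δ ^ 2 ≠ 0 := by exact_mod_cast hN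
      have h33 : Real.sqrt 3 * Real.sqrt 3 = 3 := Real.mul_self_sqrt (by norm_num)
      have hNpi : (3 * (β : ℝ) ^ 2 - δ ^ 2) * Real.pi ^ k = ((γ : ℝ) - α) * (β * Real.sqrt 3 + δ) := by
        linear_combination ((β : ℝ) * Real.sqrt 3 + δ) * (e1.symm.trans e2) - (β : ℝ) ^ 2 * Real.pi ^ k * h33
      refine hT ((γ - α) * δ / (3 * β ^ 2 - δ ^ 2)) ((γ - α) * β / (3 * β ^ 2 - δ ^ 2)) ?_
      push_cast
      rw [div_mul_eq_mul_div, ← add_div, eq_div_iff hN']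
      linear_combination hNpi

/-! ### The Remark: Apéry and Ball–Rivoal -/

/-- **Remark after Proposition 7, first sentence**: "Since it has been established by Apéry that `ζ(3)` is irrational,
we have that either `dim_ℚ V̂₃(3) = 3` or `dim_ℚ V̂₃(4) = 3`" — unconditionally, from the tree's Apéry theorem
`irrational_zetaValue_three_holds`. [cite: GunRammurtyRath2011, Remark after Proposition 7 (p. 1343)] -/
theorem finrank_three_or_four_eq_three_of_three :
    Module.finrank ℚ ↥(Submodule.span ℚ (insert (1 : ℝ) {y : ℝ | ∃ a : ℕ, 1 ≤ a ∧ a < 3 ∧ Nat.Coprime a 3 ∧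
        y = hurwitzValue 3 ((a : ℝ) / (3 : ℕ))})) = 3 ∨
      Module.finrank ℚ ↥(Submodule.span ℚ (insert (1 : ℝ) {y : ℝ | ∃ a : ℕ, 1 ≤ a ∧ a < 4 ∧ Nat.Coprime a 4 ∧
        y = hurwitzValue 3 ((a : ℝ) / (4 : ℕ))})) = 3 :=
  (finrank_three_or_four_eq_three_iff_irrational (k := 3) (by decide) (by norm_num)).2 irrational_zetaValue_three_holds

/-- **Remark after Proposition 7, second sentence**: "by a result of Rivoal and Ball, `ζ(k)` is irrational for
infinitely many odd `k`. Thus for infinitely many odd `k`, either `dim_ℚ V̂_k(3) = 3` or `dim_ℚ V̂_k(4) = 3`" —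
unconditionally, from the tree's Ball–Rivoal theorem `infinite_setOf_irrational_zetaValue_odd_holds` (the set of `m`
with `k = 2m + 1` qualifying is infinite). [cite: GunRammurtyRath2011, Remark after Proposition 7 (p. 1343)] -/
theorem infinite_setOf_finrank_three_or_four_eq_three :
    {m : ℕ | Module.finrank ℚ ↥(Submodule.span ℚ (insert (1 : ℝ) {y : ℝ | ∃ a : ℕ, 1 ≤ a ∧ a < 3 ∧
        Nat.Coprime a 3 ∧ y = hurwitzValue (2 * m + 1) ((a : ℝ) / (3 : ℕ))})) = 3 ∨
      Module.finrank ℚ ↥(Submodule.span ℚ (insert (1 : ℝ) {y : ℝ | ∃ a : ℕ, 1 ≤ a ∧ a < 4 ∧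
        Nat.Coprime a 4 ∧ y = hurwitzValue (2 * m + 1) ((a : ℝ) / (4 : ℕ))})) = 3}.Infinite := by
  refine (infinite_setOf_irrational_zetaValue_odd_holds).mono fun m hm => ?_
  have hm' : Irrational (zetaValue (2 * m + 1)) := hm
  rcases Nat.eq_zero_or_pos m with rfl | hm0
  · -- `m = 0` is not in the set: `zetaValue 1` is the junk value `0` of a divergent series
    exfalso
    have hns : ¬ Summable (fun n : ℕ => 1 / (n : ℝ) ^ (2 * 0 + 1)) := by
      rw [Real.summable_one_div_nat_pow]
      norm_num
    rw [zetaValue, tsum_eq_zero_of_not_summable hns] at hm'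
    exact hm' ⟨0, Rat.cast_zero⟩
  · exact (finrank_three_or_four_eq_three_iff_irrational (k := 2 * m + 1) ⟨m, rfl⟩ (by omega)).2 hm'

end Literature.NumberTheory.Irrationality.DirichletLValues

end
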